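import Summits.Ventures.CertifiedManyBodySolver.Theorems.R2cStripCellSectorConsumers
import Summits.Ventures.CertifiedManyBodySolver.Theorems.R2cStripCellEnergyDensity
import HarnessLib

/-!
# Strip-cell uMPS certificates → energy-density rows: per-sector dual and producer-free bond-matrix bound (add-on v2.2)

HONEST FRAMING: first certified bounds; not a superconductivity verdict; every number certified or labelled float.
NO NUMBER IS CLAIMED HERE (every theorem is an implication from a certificate's data; `proof.conditional` by design).
Pen of `R2cOpenStripTangentLine` (sr-mbsolver-var-7 g19, 2026-08-27), on top of hubbard-r2c-p1's ROW-MAKER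
`energyDensityTT'_le_of_stripCell_umps_dual_dyadic` (`Theorems/R2cStripCellEnergyDensity.lean`: any cell `c × W`, exact
cell charge `0 < Q_c < 2cW`, `t′ = 0`, `U ≥ 0` ⟹ `e(t,0,U, Q_c/(cW)) ≤ c_cert/(cW)`) and of the add-on v2 modules
(`Upper/StripCellDualSectors.lean`, `Upper/StripCellStructure.lean`, `Upper/StripCellRowSum.lean`,
`Theorems/R2cStripCellSectorConsumers.lean`, whose consumers end in the LEAF `M3Upper_tp0_le_m18o25` at the fixed filling
`8·Q_c = 7·cW`). This file gives the same two discharges for the ENERGY-DENSITY form — the entry point of a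
LEADERBOARD-class strip row at ANY `(c, W, Q_c)` whose value does not (yet) clear a leaf's bar (e.g. the `W = 4` BD-STRIP
glide cell, `e_TI ≈ −0.70 [FLOAT] > −18/25`):

* `energyDensityTT'_le_of_stripCell_umps_dual_dyadic_sectors` — the dense dual hypothesis
  `(c_cert − η)·1 − W(A; hh, Z) ⪰ 0` replaced by ONE PSD principal block per occurring cut label (the shape
  `bd-strip-cell-v1` emits; `Z` label-diagonal), via `Upper.posSemidef_sub_dualMatrix_of_sectors` +
  `Upper.stripCellBondMatrix_conservesCharge`;
* `energyDensityTT'_le_of_stripCell_umps_dual_dyadic_structural_sectors` — additionally `hγ hX₁ hX₂` DISCHARGED by the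
  producer-free Geršgorin/Loewner bound `stripCellBondMatrix_loewner` at the closed form
  `γ₀(c,W,t,U) = |t|·(4((c−1)W + c(W−1)) + 4W) + |U|·cW` (`= 240` at `c = W = 4`, `(t,U) = (1,8)`; `= 4·108 + 16 + 512 = 960` for
  the `16 × 4` glide cell);
* `energyDensityTT'_le_of_exists_stripCellCert` — CLAIM-NODE PACKAGING: the tensor data in ONE existential proposition, the
  scalar side conditions outside as `norm_num` goals.

Sources: Ruelle, *Statistical Mechanics* (1969) §3.3–3.4 [Ruelle1969]; Horn–Johnson, *Matrix Analysis* (2013) Thm 6.1.1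
(Geršgorin) [HornJohnson2013]; VAR `METHOD-umps.md` Thm U1; eng-1 `FORMAT-bdstrip-cell-v1.md`.
-/

noncomputable section

open Matrix Finset
open scoped ComplexOrder BigOperators

namespace Summit.Ventures.CertifiedManyBodySolver.Theorems

open Literature.MathematicalPhysics.QuantumLattice
open Literature.MathematicalPhysics.QuantumLattice.ThermodynamicLimit
open Summit.Ventures.CertifiedManyBodySolver.Upper

variable {c W Q D : ℕ}

/-- **Row-maker, STORED (dyadic) tensor, PER-SECTOR dual certificate.** hubbard-r2c-p1's
`energyDensityTT'_le_of_stripCell_umps_dual_dyadic` with the dense hypothesis `(c_cert − η)·1 − W(A; hh, Z) ⪰ 0` replaced by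
one positive-semidefinite principal block per occurring cut label `q` (`emb q : Fin (m q) → Fin D` injective, covering the
label class; `Z` label-diagonal); block-diagonality of the dual is `posSemidef_sub_dualMatrix_of_sectors` with the
producer-free `stripCellBondMatrix_conservesCharge`. Conclusion: `e(t,0,U, Q_c/(cW)) ≤ c_cert/(cW)`. [cite: Ruelle1969, §3.4] -/
theorem energyDensityTT'_le_of_stripCell_umps_dual_dyadic_sectors (W c : ℕ) (hW : 1 ≤ W) (hc : 0 < c)
    (κ : TensorIndex (Fin c ×ₗ Fin W) 4 ≃ Fin Q) (A : MPSTensor Q D) (t : ℝ) {U : ℝ} (hU : 0 ≤ U)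
    {ε γ η cc z : ℝ} (hε0 : 0 ≤ ε) (hε1 : ε < 1) (hγ : 0 ≤ γ) (hz : 0 ≤ z)
    (hG : ∀ i, ∑ j, ‖(Upper.gram A - 1) i j‖ ≤ ε)
    (hX₁ : ((γ : ℂ) • (1 : Matrix (Fin Q × Fin Q) (Fin Q × Fin Q) ℂ) - stripCellBondMatrix κ hc t U).PosSemidef)
    (hX₂ : ((γ : ℂ) • (1 : Matrix (Fin Q × Fin Q) (Fin Q × Fin Q) ℂ) + stripCellBondMatrix κ hc t U).PosSemidef)
    (r : Fin D → ℂ) (hr : star r ⬝ᵥ r = 1) (Z : Matrix (Fin D) (Fin D) ℂ)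
    (hZ₁ : (((z : ℝ) : ℂ) • (1 : Matrix (Fin D) (Fin D) ℂ) - Z).PosSemidef)
    (hZ₂ : (((z : ℝ) : ℂ) • (1 : Matrix (Fin D) (Fin D) ℂ) + Z).PosSemidef)
    (hη : (1 + 1 / (1 - ε)) * (ε / (1 - ε)) * (1 + ε) * (γ * (1 + (1 + ε)) + z) ≤ η)
    (lab : Fin D → ℤ) (Qc qmin qmax : ℤ)
    (hBC : ∀ (S : Fin Q) (α β : Fin D), A S α β ≠ 0 → lab β + Qc = lab α + cellCharge κ S)
    (hlab : ∀ α, qmin ≤ lab α ∧ lab α ≤ qmax) (hQ0 : 0 < Qc) (hQ2 : Qc < 2 * ((c : ℤ) * (W : ℤ)))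
    (hZb : ∀ α β, Z α β ≠ 0 → lab α = lab β)
    {m : ℤ → ℕ} (emb : ∀ q, Fin (m q) → Fin D) (hinj : ∀ q, Function.Injective (emb q))
    (hcover : ∀ α, ∃ i, emb (lab α) i = α)
    (hpsd : ∀ q ∈ Finset.univ.image lab,
      (((((cc - η : ℝ) : ℂ)) • (1 : Matrix (Fin D) (Fin D) ℂ) -
          dualMatrix A (stripCellBondMatrix κ hc t U) Z).submatrix (emb q) (emb q)).PosSemidef) :
    energyDensityTT' t 0 U (((Qc : ℤ) : ℝ) / ((c : ℝ) * (W : ℝ))) ≤ cc / ((c : ℝ) * (W : ℝ)) :=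
  energyDensityTT'_le_of_stripCell_umps_dual_dyadic W c hW hc κ A t hU hε0 hε1 hγ hz hG hX₁ hX₂ r hr Z hZ₁ hZ₂ hη
    (posSemidef_sub_dualMatrix_of_sectors A lab Qc (cellCharge κ) hBC (stripCellBondMatrix κ hc t U)
      (stripCellBondMatrix_conservesCharge κ hc t U) Z hZb _ emb hinj hcover hpsd)
    lab Qc qmin qmax hBC hlab hQ0 hQ2

/-- **Row-maker, STORED (dyadic) tensor, PER-SECTOR dual certificate, PRODUCER-FREE bond-matrix bound** — the by-value entry
point of a `bd-strip-cell-v1` certificate as an energy-density ROW at any `(c, W, Q_c)`: `…_dyadic_sectors` with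
`hγ hX₁ hX₂` discharged by `stripCellBondMatrix_loewner` at `γ₀ = |t|·(4((c−1)W + c(W−1)) + 4W) + |U|·cW` (the closed form of
`stripCellRowBound c W t U`). Readers' remaining inputs: the Gram defect `ε`, `r`, label-diagonal `Z` with `z·1 ∓ Z ⪰ 0`, the
slack `η ≥ (1 + 1/(1−ε))·(ε/(1−ε))·(1+ε)·(γ₀(2+ε) + z)`, the per-sector blocks of `(c_cert − η)·1 − W(A; hh, Z)`, the block
rule and window, `0 < Q_c < 2cW`. [cite: Ruelle1969, §3.4] [cite: HornJohnson2013, Thm. 6.1.1] -/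
theorem energyDensityTT'_le_of_stripCell_umps_dual_dyadic_structural_sectors (W c : ℕ) (hW : 1 ≤ W) (hc : 0 < c)
    (κ : TensorIndex (Fin c ×ₗ Fin W) 4 ≃ Fin Q) (A : MPSTensor Q D) (t : ℝ) {U : ℝ} (hU : 0 ≤ U)
    {ε η cc z : ℝ} (hε0 : 0 ≤ ε) (hε1 : ε < 1) (hz : 0 ≤ z)
    (hG : ∀ i, ∑ j, ‖(Upper.gram A - 1) i j‖ ≤ ε)
    (r : Fin D → ℂ) (hr : star r ⬝ᵥ r = 1) (Z : Matrix (Fin D) (Fin D) ℂ)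
    (hZ₁ : (((z : ℝ) : ℂ) • (1 : Matrix (Fin D) (Fin D) ℂ) - Z).PosSemidef)
    (hZ₂ : (((z : ℝ) : ℂ) • (1 : Matrix (Fin D) (Fin D) ℂ) + Z).PosSemidef)
    (hη : (1 + 1 / (1 - ε)) * (ε / (1 - ε)) * (1 + ε) *
      ((|t| * (4 * (((c - 1) * W + c * (W - 1) : ℕ) : ℝ) + 4 * W) + |U| * (c * W)) * (1 + (1 + ε)) + z) ≤ η)
    (lab : Fin D → ℤ) (Qc qmin qmax : ℤ)
    (hBC : ∀ (S : Fin Q) (α β : Fin D), A S α β ≠ 0 → lab β + Qc = lab α + cellCharge κ S)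
    (hlab : ∀ α, qmin ≤ lab α ∧ lab α ≤ qmax) (hQ0 : 0 < Qc) (hQ2 : Qc < 2 * ((c : ℤ) * (W : ℤ)))
    (hZb : ∀ α β, Z α β ≠ 0 → lab α = lab β)
    {m : ℤ → ℕ} (emb : ∀ q, Fin (m q) → Fin D) (hinj : ∀ q, Function.Injective (emb q))
    (hcover : ∀ α, ∃ i, emb (lab α) i = α)
    (hpsd : ∀ q ∈ Finset.univ.image lab,
      (((((cc - η : ℝ) : ℂ)) • (1 : Matrix (Fin D) (Fin D) ℂ) -
          dualMatrix A (stripCellBondMatrix κ hc t U) Z).submatrix (emb q) (emb q)).PosSemidef) :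
    energyDensityTT' t 0 U (((Qc : ℤ) : ℝ) / ((c : ℝ) * (W : ℝ))) ≤ cc / ((c : ℝ) * (W : ℝ)) := by
  have hγ : stripCellRowBound c W t U =
      |t| * (4 * (((c - 1) * W + c * (W - 1) : ℕ) : ℝ) + 4 * W) + |U| * (c * W) := stripCellRowBound_eq c W t U
  have hγ0 : (0 : ℝ) ≤ |t| * (4 * (((c - 1) * W + c * (W - 1) : ℕ) : ℝ) + 4 * W) + |U| * (c * W) := by positivity
  obtain ⟨hX₁, hX₂⟩ := stripCellBondMatrix_loewner κ hc t U hγ.le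
  exact energyDensityTT'_le_of_stripCell_umps_dual_dyadic_sectors W c hW hc κ A t hU hε0 hε1 hγ0 hz hG hX₁ hX₂ r hr Z
    hZ₁ hZ₂ hη lab Qc qmin qmax hBC hlab hQ0 hQ2 hZb emb hinj hcover hpsd

/-- **CLAIM-NODE PACKAGING (energy-density row).** The shape a `Certificates/…` claim node for a `bd-strip-cell-v1`
certificate takes when its value does not clear a leaf's bar: the tensor data `A, r, Z, lab, m, emb` existentially packaged
in ONE proposition (`hex`, literally the body a node `@[conjecture] def cert_X : Prop := ∃ A r Z lab m emb, …` would carry),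
the scalar side conditions (`0 ≤ ε < 1`, `0 ≤ z`, the slack inequality, `0 < Q_c < 2cW`) outside as `norm_num` goals.
Conclusion `e(t,0,U, Q_c/(cW)) ≤ c_cert/(cW)`. HONEST FRAMING: nothing here asserts that such a certificate exists. -/
theorem energyDensityTT'_le_of_exists_stripCellCert (W c : ℕ) (hW : 1 ≤ W) (hc : 0 < c)
    (κ : TensorIndex (Fin c ×ₗ Fin W) 4 ≃ Fin Q) (D : ℕ) (t : ℝ) {U : ℝ} (hU : 0 ≤ U) (ε η cc z : ℝ)
    (Qc qmin qmax : ℤ) (hε0 : 0 ≤ ε) (hε1 : ε < 1) (hz : 0 ≤ z)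
    (hη : (1 + 1 / (1 - ε)) * (ε / (1 - ε)) * (1 + ε) *
      ((|t| * (4 * (((c - 1) * W + c * (W - 1) : ℕ) : ℝ) + 4 * W) + |U| * (c * W)) * (1 + (1 + ε)) + z) ≤ η)
    (hQ0 : 0 < Qc) (hQ2 : Qc < 2 * ((c : ℤ) * (W : ℤ)))
    (hex : ∃ (A : MPSTensor Q D) (r : Fin D → ℂ) (Z : Matrix (Fin D) (Fin D) ℂ) (lab : Fin D → ℤ)
        (m : ℤ → ℕ) (emb : ∀ q, Fin (m q) → Fin D),
        (∀ i, ∑ j, ‖(Upper.gram A - 1) i j‖ ≤ ε) ∧ star r ⬝ᵥ r = 1 ∧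
        ((((z : ℝ) : ℂ)) • (1 : Matrix (Fin D) (Fin D) ℂ) - Z).PosSemidef ∧
        ((((z : ℝ) : ℂ)) • (1 : Matrix (Fin D) (Fin D) ℂ) + Z).PosSemidef ∧
        (∀ (S : Fin Q) (α β : Fin D), A S α β ≠ 0 → lab β + Qc = lab α + cellCharge κ S) ∧
        (∀ α, qmin ≤ lab α ∧ lab α ≤ qmax) ∧ (∀ α β, Z α β ≠ 0 → lab α = lab β) ∧
        (∀ q, Function.Injective (emb q)) ∧ (∀ α, ∃ i, emb (lab α) i = α) ∧
        (∀ q ∈ Finset.univ.image lab,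
          (((((cc - η : ℝ) : ℂ)) • (1 : Matrix (Fin D) (Fin D) ℂ) -
              dualMatrix A (stripCellBondMatrix κ hc t U) Z).submatrix (emb q) (emb q)).PosSemidef)) :
    energyDensityTT' t 0 U (((Qc : ℤ) : ℝ) / ((c : ℝ) * (W : ℝ))) ≤ cc / ((c : ℝ) * (W : ℝ)) := by
  obtain ⟨A, r, Z, lab, m, emb, hG, hr, hZ₁, hZ₂, hBC, hlab, hZb, hinj, hcover, hpsd⟩ := hex
  exact energyDensityTT'_le_of_stripCell_umps_dual_dyadic_structural_sectors W c hW hc κ A t hU hε0 hε1 hz hG r hr Z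
    hZ₁ hZ₂ hη lab Qc qmin qmax hBC hlab hQ0 hQ2 hZb emb hinj hcover hpsd

/-- By-value sanity of the producer-free constant for the `16 × 4` glide cell at `(t, U) = (1, 8)`:
`γ₀ = 4·((16−1)·4 + 16·(4−1)) + 4·4 + 8·64 = 4·108 + 16 + 512 = 960`. -/
example : |(1 : ℝ)| * (4 * ((((16 : ℕ) - 1) * 4 + 16 * (4 - 1) : ℕ) : ℝ) + 4 * (4 : ℕ)) + |(8 : ℝ)| * ((16 : ℕ) * (4 : ℕ))
    = 960 := by
  norm_num

end Summit.Ventures.CertifiedManyBodySolver.Theorems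

end
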